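import Summits.Parity.GeneralizedHardyLittlewood.Theses.ClassVarianceLadder
import Literature.NumberTheory.Sieve.HardyLittlewoodChowla

/-!
# Strategy census r1 — typed companions for `MobiusCofactorAtom` (stmt-Parity-13833)

Companion signatures for `STRATEGY-CENSUS-r1.md` (crux-strategist REDIRECT r1, second opinion after
`STRATEGY-CENSUS.md` / `StrategyCensus.lean` of seat s2). Everything here ELABORATES; the two `theorem`s
are proved; the `def … : Prop`s are the signatures the census discusses (none is filed as an item).

* `StuckGoal` — the forced `t = 1`, `m = 3` content of the crux (see `PlacementR1.lean`,
  `vonMangoldt_moebius_logSaving_of_atom : MobiusCofactorAtom → StuckGoal`-shape): fixed-shift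
  `Σ_{n ≤ X} Λ(n) μ(n+h) ≪_A X/(log X)^A`.
* `not_isFiniteComplexitySystem_one` — **every one-variable system of ≥ 2 forms has infinite
  complexity** (census §Transfer T4: the summit's own engine, Green–Tao for finite-complexity systems,
  is silent on every instance the crux quantifies over).
* `UnweightedCofactorAtom` — the crux with the prime-tuple weight `∏ Λ(ψ_i(n))` replaced by `1`
  (census §Strengthen S1: this weakening is a THEOREM-type statement — Möbius in a fixed arithmetic
  progression to bounded modulus, Siegel–Walfisz/PNT for `μ` — locating the whole difficulty in the
  coupling "cofactor Möbius × primality of the other forms").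
* `MoebiusBVShifted`, `DilatedBinaryChowlaUniform`, `SplitGlue` — census §Decomposition D1 (open `Λ = μ ⋆ log`
  on the FIRST form): piece A is Bombieri–Vinogradov-type for `μ` (known type), piece B is binary Chowla
  along the dilated pattern `(d, md + h)` uniformly in `m ≤ √X (log X)^B` (open; contains plain two-point
  Chowla with a log-power saving at `m = 1`), `SplitGlue` the routine partial-summation glue (unproved here).
-/

namespace Summit.Parity.GeneralizedHardyLittlewood.Cruxes.MobiusCofactorAtom.StrategyCensusR1

open Finset
open scoped ArithmeticFunction.vonMangoldt ArithmeticFunction.Moebius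
open Literature.NumberTheory.Sieve

/-- **F1 / stuck goal.** Fixed-shift von Mangoldt–Möbius two-point sum with every log-power saving
(= quantitative Hardy–Littlewood–Chowla, `k = ℓ = 1`; implied by the crux at `t = 1`, `Ψ = (n ; 3n+3h)`,
`m = 3`, `PlacementR1.vonMangoldt_moebius_logSaving_of_atom`). [conjecture] -/
def StuckGoal : Prop :=
  ∀ h : ℕ, 1 ≤ h → ∀ A : ℝ, 0 < A → ∃ X₀ : ℕ, ∀ X : ℕ, X₀ ≤ X →
    |∑ n ∈ Icc 1 X, Λ n * (μ (n + h) : ℝ)| ≤ (X : ℝ) / Real.log X ^ A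

/-- **T4.** In one variable (`d = 1`) any two linear parts are parallel, so NO system of `s ≥ 2` forms
has finite complexity: the crux (over `AffLinForm 1`, `t + 1 ≥ 2` forms) quantifies only over
infinite-complexity systems, on which `Green–Tao 2010` (the summit's engine) says nothing. [folklore] -/
theorem not_isFiniteComplexitySystem_one {s : ℕ} (hs : 2 ≤ s) (Ψ : Fin s → AffLinForm 1) :
    ¬ IsFiniteComplexitySystem Ψ := by
  intro hΨ
  set i : Fin s := ⟨0, by omega⟩
  set j : Fin s := ⟨1, by omega⟩
  have hij : i ≠ j := by simp [i, j, Fin.ext_iff]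
  by_cases hi : (Ψ i).coeff 0 = 0
  · have h := hΨ i j hij 1 0 (by
      funext k
      have hk : k = 0 := Fin.eq_zero k
      subst hk
      simp [hi])
    exact one_ne_zero h.1
  · have h := hΨ i j hij ((Ψ j).coeff 0) ((Ψ i).coeff 0) (by
      funext k
      have hk : k = 0 := Fin.eq_zero k
      subst hk
      simp [mul_comm])
    exact hi h.2

/-- In particular the forced instances of `PlacementR1` (and every `Ψ` the crux speaks about, `t ≥ 1`)
are infinite-complexity systems. [folklore] -/
theorem crux_systems_infinite_complexity (t : ℕ) (ht : 1 ≤ t) (Ψ : Fin (t + 1) → AffLinForm 1) :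
    ¬ IsFiniteComplexitySystem Ψ :=
  not_isFiniteComplexitySystem_one (by omega) Ψ

/-- **S1 (the weakening that is known-type).** The crux with the prime-tuple weight dropped: for each
dilation `m`, `Σ_{n ∈ [u,v], ψ_{t+1}(n) ≥ 1, m ∣ ψ_{t+1}(n)} μ(ψ_{t+1}(n)/m)` is a Möbius sum over a segment of
an arithmetic progression of modulus `≤ ‖Ψ‖_N ≤ L` and length `≍ LN/m` — Siegel–Walfisz / PNT for `μ` in
progressions to bounded moduli gives each term `≪ L·(LN/m)·exp(-c√log N)`, whence (summing `log m / m` over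
`m ≤ N^δ`) the whole `m`-sum is `≪ L²·N·(log N)²·exp(-c√log N) ≤ N/(log N)^A` for `N` large. Recorded to LOCALISE the difficulty: it is
entirely the coupling of `μ(cofactor)` with the primality of the other `t` forms. [folklore] -/
def UnweightedCofactorAtom : Prop :=
  ∀ t : ℕ, 1 ≤ t → ∀ (L : ℕ) (A : ℝ), 0 < A → ∃ δ : ℝ, 0 < δ ∧ ∃ N₀ : ℕ, ∀ N : ℕ, N₀ ≤ N →
    ∀ Ψ : Fin (t + 1) → AffLinForm 1, IsNondegenerateSystem Ψ → affLinSize Ψ N ≤ L →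
      ∀ u v : ℤ, -(N : ℤ) ≤ u → v ≤ N →
        ∑ m ∈ Icc 1 ⌊(N : ℝ) ^ δ⌋₊, Real.log m *
          |∑ n ∈ (Icc u v).filter (fun n : ℤ => 1 ≤ (Ψ (Fin.last t)).eval (fun _ => n) ∧
              (m : ℤ) ∣ (Ψ (Fin.last t)).eval (fun _ => n)),
            (μ (((Ψ (Fin.last t)).eval (fun _ => n)).toNat / m) : ℝ)| ≤ (N : ℝ) / Real.log N ^ A

/-- **D1, piece A (known type: Bombieri–Vinogradov for `μ`, log-twisted, one residue class per modulus).**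
`Σ_{d ≤ √X/(log X)^B} |Σ_{m ≤ X/d} log m · μ(dm + h)| ≤ X/(log X)^A`. [folklore] -/
def MoebiusBVShifted : Prop :=
  ∀ h : ℕ, 1 ≤ h → ∀ A : ℝ, 0 < A → ∃ B : ℝ, ∃ X₀ : ℕ, ∀ X : ℕ, X₀ ≤ X →
    ∑ d ∈ Icc 1 ⌊Real.sqrt X / Real.log X ^ B⌋₊,
      |∑ m ∈ Icc 1 (X / d), Real.log m * (μ (d * m + h) : ℝ)| ≤ (X : ℝ) / Real.log X ^ A

/-- **D1, piece B (OPEN: dilated binary Chowla, uniform in the dilation).** For every `m ≤ √X (log X)^B`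
and every tail `[D, X/m]`: `|Σ_{D ≤ d ≤ X/m} μ(d) μ(md + h)| ≤ (X/m)/(log X)^A`. At `m = 1`, `D = 1` this is
two-point Chowla with a log-power saving — open (only logarithmically averaged forms are known).
[conjecture] -/
def DilatedBinaryChowlaUniform : Prop :=
  ∀ h : ℕ, 1 ≤ h → ∀ A B : ℝ, 0 < A → ∃ X₀ : ℕ, ∀ X : ℕ, X₀ ≤ X → ∀ m : ℕ, 1 ≤ m →
    (m : ℝ) ≤ Real.sqrt X * Real.log X ^ B → ∀ D : ℕ,
      |∑ d ∈ Icc D (X / m), (μ d : ℝ) * (μ (m * d + h) : ℝ)| ≤ (X : ℝ) / m / Real.log X ^ A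

/-- **D1 glue** (`Λ(n) = Σ_{dm = n} μ(d) log m`, split at `d ≤ √X/(log X)^B`; routine partial summation,
NOT proved here — the census records why the split is not filed: piece B is the whole difficulty).
[folklore] -/
def SplitGlue : Prop := MoebiusBVShifted → DilatedBinaryChowlaUniform → StuckGoal

end Summit.Parity.GeneralizedHardyLittlewood.Cruxes.MobiusCofactorAtom.StrategyCensusR1
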